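import Literature.Analysis.FluidPDE.VorticityEquation
import Literature.Analysis.FluidPDE.SelfSimilarEulerVorticityCompactSupport
import HarnessLib

/-!
# Euler flows: the volume of the vorticity support is conserved (Eulerian proof)

Analysis/FluidPDE proofs file (theorems only; no definitions, no named facts). For a classical
solution of the incompressible Euler equations the vorticity is transported by the flow and
stretched by the Jacobian — the vorticity transport formula `ω(X(α,t),t) = ∇ₐX(α,t) ω₀(α)`
(Majda–Bertozzi, *Vorticity and Incompressible Flow*, §1.6 Prop. 1.8, eq. (1.51)); since the flow
map `X(·,t)` is volume preserving (§1.3 Prop. 1.4: `div u = 0` iff `J ≡ 1`), the support of the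
vorticity is carried onto itself and **its Lebesgue measure is constant in time**. This is the fact
behind Chae's exclusion of self-similar Euler blow-up with decaying vorticity (Chae 2007; cited as
[cha] in Chae–Shvydkoy 2013 §4) and behind the discretely-self-similar exclusion in the tree's
`Summits/…/EulerZoomLiouvillePowerGaugeEulerLiouvilleDSSCompactVorticity`.

We prove it WITHOUT the Lagrangian flow (which the tree does not have for general classical
solutions), for the vorticity formulation `IsVorticitySolutionOn S 0 u` (`∂ₜω + (u·∇)ω = (ω·∇)u`,
`div u = 0`, jointly smooth `u`; `VorticityEquation.lean` derives it from `IsClassicalEulerSolutionOn`)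
on an open time set `S ⊇ [τ₁, τ₂]`, under the hypothesis that the vorticity is supported in a fixed
compact set `K` for all `σ ∈ [τ₁, τ₂]`:

* `IsVorticitySolutionOn.abs_integral_rpow_vorticity_sub_le` — **the `L^{2a}` quasi-invariance**:
  for `0 < a ≤ 1`, `|∫ |ω(τ₂)|^{2a} − ∫ |ω(τ₁)|^{2a}| ≤ 2a · S_d · max(1, F) · |K| · (τ₂ − τ₁)`, where
  `S_d` bounds `‖Du‖` and `F` bounds `|ω|²` on `[τ₁,τ₂] × K`. Proof: for `ε > 0` the regularised
  power `G_ε = (|ω|² + ε)^a − ε^a` satisfies `∂ₜG_ε + div(G_ε u) = 2a(|ω|²+ε)^{a−1}⟪ω, Du ω⟫`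
  pointwise; integrate over `[τ₁,τ₂] × ℝ³` (Fubini, the fundamental theorem of calculus on time
  lines, `∫ div(G_ε u) dx = 0`), bound the stretching term by `2a S_d |ω|^{2a} ≤ 2a S_d max(1,F)`
  on `K`, and let `ε → 0`.
* `IsVorticitySolutionOn.volume_support_vorticity_eq` — **conservation of the support volume**:
  `vol {ω(τ₂) ≠ 0} = vol {ω(τ₁) ≠ 0}`; the limit `a → 0` of the previous bound, since
  `∫ |ω(σ)|^{2a} → vol {ω(σ) ≠ 0}` (dominated convergence on `K`).

## References

* A. J. Majda, A. L. Bertozzi, *Vorticity and Incompressible Flow* (CUP 2002), §1.6 Prop. 1.8 and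
  eq. (1.51) (vorticity transport formula), §1.3 Prop. 1.4 (incompressible flows preserve volume).
  [MajdaBertozziCUP2002]
* D. Chae, R. Shvydkoy, ARMA 209 (2013) = arXiv:1201.6009, §4 (use of [cha] = Chae 2007).
  [ChaeShvydkoy2013]

## Mathlib / tree search

Reused: `IsVorticitySolutionOn` (`Vorticity`), `IsSmoothSpaceTimeOn.isSmoothSpaceTimeOn_vorticity`,
`.fderiv_slice`, `.timeDerivWithin`, `.hasDerivWithinAt_timeDerivWithin`, `.continuousOn`
(`ClassicalSolutionCalculus`, `AxisymmetricVorticityTransport`), `integrable_prod_of_continuousOn`,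
`integral_mul_divergence_add_eq_zero_left` (`WholeSpaceIBP`), the regularised-power calculus of
`SelfSimilarEulerVorticityCompactSupport`; Mathlib `integral_integral_swap`,
`intervalIntegral.integral_eq_sub_of_hasDerivAt`, `tendsto_integral_of_dominated_convergence`,
`integral_indicator_one`. `lean search 'volume.*support.*vorticity|tsupport (vorticity'`: nothing.
-/

noncomputable section

open MeasureTheory Set Filter Function Topology InnerProductSpace Metric
open scoped RealInnerProductSpace NNReal ENNReal

namespace Literature.Analysis.FluidPDE

namespace IsVorticitySolutionOn

variable {S : Set ℝ} {u : ℝ → EuclideanSpace ℝ (Fin 3) → EuclideanSpace ℝ (Fin 3)}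

/-- **`L^{2a}` quasi-invariance of the vorticity of an Euler flow with compactly supported
vorticity.** Let `u` solve the Euler vorticity formulation on an open time set `S ⊇ [τ₁, τ₂]`, with
`ω = vorticity u` vanishing off a compact set `K` for all `σ ∈ [τ₁, τ₂]`, `‖Du(σ,x)‖ ≤ S_d` on
`[τ₁,τ₂] × K` and `|ω(σ,x)|² ≤ F` on `[τ₁, τ₂] × ℝ³`. Then for every `0 < a ≤ 1`,
`|∫ |ω(τ₂)|^{2a} − ∫ |ω(τ₁)|^{2a}| ≤ 2a · (S_d · max(1,F) · |K|) · (τ₂ − τ₁)`. (Eulerian substitute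
for the transport of the vorticity support, Majda–Bertozzi Prop. 1.8: the transport term of
`∂ₜ|ω|^{2a}` is a divergence, the stretching term is `O(a)`.)
[cite: MajdaBertozziCUP2002, §1.6 Prop. 1.8 (eq. (1.51))] -/
theorem abs_integral_rpow_vorticity_sub_le (h : IsVorticitySolutionOn S 0 u) (hS : IsOpen S)
    {τ₁ τ₂ : ℝ} (hτ : τ₁ ≤ τ₂) (hsub : Icc τ₁ τ₂ ⊆ S) {K : Set (EuclideanSpace ℝ (Fin 3))}
    (hK : IsCompact K) (hsupp : ∀ σ ∈ Icc τ₁ τ₂, ∀ x ∉ K, vorticity u σ x = 0)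
    {Sd : ℝ} (hSd : ∀ σ ∈ Icc τ₁ τ₂, ∀ x ∈ K, ‖fderiv ℝ (u σ) x‖ ≤ Sd)
    {F : ℝ} (hF : ∀ σ ∈ Icc τ₁ τ₂, ∀ x, ‖vorticity u σ x‖ ^ 2 ≤ F)
    {a : ℝ} (ha : 0 < a) (ha1 : a ≤ 1) :
    |(∫ x, (‖vorticity u τ₂ x‖ ^ 2) ^ a) - ∫ x, (‖vorticity u τ₁ x‖ ^ 2) ^ a| ≤
      2 * a * (Sd * max 1 F * volume.real K) * (τ₂ - τ₁) := by
  set ω : ℝ → EuclideanSpace ℝ (Fin 3) → EuclideanSpace ℝ (Fin 3) := vorticity u with hωdef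
  have hU : UniqueDiffOn ℝ S := hS.uniqueDiffOn
  have hu := h.smooth_velocity
  have hω : IsSmoothSpaceTimeOn S ω := hu.isSmoothSpaceTimeOn_vorticity hU
  have hωt : IsSmoothSpaceTimeOn S (timeDerivWithin S ω) := hω.timeDerivWithin hU
  have hDu : IsSmoothSpaceTimeOn S (fun s y => fderiv ℝ (u s) y) := hu.fderiv_slice hU
  -- the degenerate case `K = ∅` (then `ω ≡ 0` on `[τ₁, τ₂]`)
  by_cases hKe : K = ∅
  · have h0 : ∀ σ ∈ Icc τ₁ τ₂, ∀ x, ω σ x = 0 := fun σ hσ x => hsupp σ hσ x (by simp [hKe])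
    have e : ∀ σ ∈ Icc τ₁ τ₂, (∫ x, (‖ω σ x‖ ^ 2) ^ a) = 0 := fun σ hσ => by
      simp [h0 σ hσ, Real.zero_rpow ha.ne']
    rw [e τ₂ (right_mem_Icc.2 hτ), e τ₁ (left_mem_Icc.2 hτ), sub_self, abs_zero, hKe]
    simp
  -- nonnegativity of the constants
  have hSd0 : 0 ≤ Sd := by
    obtain ⟨x, hx⟩ := nonempty_iff_ne_empty.2 hKe
    exact (norm_nonneg _).trans (hSd τ₁ (left_mem_Icc.2 hτ) x hx)
  have hF0 : 0 ≤ F := (sq_nonneg _).trans (hF τ₁ (left_mem_Icc.2 hτ) 0)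
  set C : ℝ := Sd * max 1 F * volume.real K with hCdef
  have hC0 : 0 ≤ C := by positivity
  -- continuity data
  have hω_cont : ContinuousOn (uncurry ω) (Icc τ₁ τ₂ ×ˢ univ) :=
    hω.continuousOn.mono (prod_mono hsub Subset.rfl)
  have hωt_cont : ContinuousOn (uncurry (timeDerivWithin S ω)) (Icc τ₁ τ₂ ×ˢ univ) :=
    hωt.continuousOn.mono (prod_mono hsub Subset.rfl)
  have hDu_cont : ContinuousOn (uncurry fun s y => fderiv ℝ (u s) y) (Icc τ₁ τ₂ ×ˢ univ) :=
    hDu.continuousOn.mono (prod_mono hsub Subset.rfl)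
  have hu_cont : ContinuousOn (uncurry u) (Icc τ₁ τ₂ ×ˢ univ) :=
    hu.continuousOn.mono (prod_mono hsub Subset.rfl)
  -- slices
  have hωs : ∀ σ ∈ S, ContDiff ℝ 1 (ω σ) := fun σ hσ => (hω.contDiff_slice hσ).of_le (by norm_num)
  have hus : ∀ σ ∈ S, ContDiff ℝ 1 (u σ) := fun σ hσ => (hu.contDiff_slice hσ).of_le (by norm_num)
  -- pointwise bound on `|ω|^{2a}` on `[τ₁, τ₂]`: `≤ max 1 F` on `K`, `0` off `K`
  have hfa_le : ∀ σ ∈ Icc τ₁ τ₂, ∀ x, (‖ω σ x‖ ^ 2) ^ a ≤ K.indicator (fun _ => max 1 F) x := by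
    intro σ hσ x
    by_cases hx : x ∈ K
    · rw [indicator_of_mem hx]
      by_cases h1 : ‖ω σ x‖ ^ 2 ≤ 1
      · exact (Real.rpow_le_one (sq_nonneg _) h1 ha.le).trans (le_max_left _ _)
      · have h1' : 1 ≤ ‖ω σ x‖ ^ 2 := (not_le.1 h1).le
        calc (‖ω σ x‖ ^ 2) ^ a ≤ (‖ω σ x‖ ^ 2) ^ (1 : ℝ) :=
              Real.rpow_le_rpow_of_exponent_le h1' ha1
          _ = ‖ω σ x‖ ^ 2 := Real.rpow_one _
          _ ≤ max 1 F := (hF σ hσ x).trans (le_max_right _ _)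
    · rw [indicator_of_notMem hx, hsupp σ hσ x hx, norm_zero]
      simp [Real.zero_rpow ha.ne']
  -- the main estimate at level `ε`
  have hlevel : ∀ ε : ℝ, 0 < ε →
      |(∫ x, ((‖ω τ₂ x‖ ^ 2 + ε) ^ a - ε ^ a)) - ∫ x, ((‖ω τ₁ x‖ ^ 2 + ε) ^ a - ε ^ a)| ≤
        2 * a * C * (τ₂ - τ₁) := by
    intro ε hε
    -- the space–time integrand `D = ∂ₜ G_ε`
    set D : ℝ × EuclideanSpace ℝ (Fin 3) → ℝ := fun z =>
      2 * a * (‖ω z.1 z.2‖ ^ 2 + ε) ^ (a - 1) * ⟪ω z.1 z.2, timeDerivWithin S ω z.1 z.2⟫ with hD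
    have hDcont : ContinuousOn D (Icc τ₁ τ₂ ×ˢ univ) := by
      have h1 : ContinuousOn (fun z : ℝ × EuclideanSpace ℝ (Fin 3) =>
          (‖ω z.1 z.2‖ ^ 2 + ε) ^ (a - 1)) (Icc τ₁ τ₂ ×ˢ univ) :=
        ((hω_cont.norm.pow 2).add continuousOn_const).rpow_const fun z _ =>
          Or.inl (ne_of_gt (add_pos_of_nonneg_of_pos (sq_nonneg _) hε))
      exact ((continuousOn_const.mul h1).mul (hω_cont.inner hωt_cont))
    have hDK : ∀ σ ∈ Icc τ₁ τ₂, ∀ x ∉ K, D (σ, x) = 0 := fun σ hσ x hx => by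
      simp only [hD]
      rw [hsupp σ hσ x hx, inner_zero_left, mul_zero]
    have hDint := integrable_prod_of_continuousOn hK hDcont hDK
    have hswap := integral_integral_swap (f := fun σ x => D (σ, x)) hDint
    -- time lines: `∫_{τ₁}^{τ₂} D(σ, x) dσ = G_ε(τ₂, x) − G_ε(τ₁, x)`
    have hline : ∀ x, ∫ σ in Ioo τ₁ τ₂, D (σ, x) =
        ((‖ω τ₂ x‖ ^ 2 + ε) ^ a - ε ^ a) - ((‖ω τ₁ x‖ ^ 2 + ε) ^ a - ε ^ a) := by
      intro x
      rcases eq_or_lt_of_le hτ with heq | hlt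
      · rw [heq]; simp
      have hderiv : ∀ σ ∈ Icc τ₁ τ₂, HasDerivAt (fun s => (‖ω s x‖ ^ 2 + ε) ^ a - ε ^ a)
          (D (σ, x)) σ := by
        intro σ hσ
        have hσS : σ ∈ S := hsub hσ
        have h1 : HasDerivAt (fun s => ω s x) (timeDerivWithin S ω σ x) σ :=
          (hω.hasDerivWithinAt_timeDerivWithin hU hσS x).hasDerivAt (hS.mem_nhds hσS)
        have h2 := ((h1.norm_sq.add_const ε).rpow_const (p := a)
          (Or.inl (by positivity))).sub_const (ε ^ a)
        refine h2.congr_deriv ?_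
        simp only [hD]
        ring
      have hcont : ContinuousOn (fun s => (‖ω s x‖ ^ 2 + ε) ^ a - ε ^ a) (Icc τ₁ τ₂) :=
        fun σ hσ => (hderiv σ hσ).continuousAt.continuousWithinAt
      have hint : IntervalIntegrable (fun σ => D (σ, x)) volume τ₁ τ₂ := by
        refine ContinuousOn.intervalIntegrable ?_
        rw [uIcc_of_le hτ]
        exact hDcont.comp (Continuous.prodMk_left x).continuousOn
          fun σ hσ => mk_mem_prod hσ (mem_univ x)
      have := intervalIntegral.integral_eq_sub_of_hasDerivAt_of_le hτ hcont
        (fun σ hσ => (hderiv σ (Ioo_subset_Icc_self hσ))) hint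
      rw [intervalIntegral.integral_of_le hτ, integral_Ioc_eq_integral_Ioo] at this
      exact this
    -- space slices: `∫ D(σ, x) dx = 2a ∫ (f+ε)^{a−1} ⟪ω, Du ω⟫` (the transport term is a divergence)
    have hslice : ∀ σ ∈ Icc τ₁ τ₂, |∫ x, D (σ, x)| ≤ 2 * a * C := by
      intro σ hσ
      have hσS : σ ∈ S := hsub hσ
      have hΩ1 : ContDiff ℝ 1 (ω σ) := hωs σ hσS
      have hΩd : Differentiable ℝ (ω σ) := hΩ1.differentiable one_ne_zero
      have hu1 : ContDiff ℝ 1 (u σ) := hus σ hσS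
      -- the regularised power on the slice and its compact support
      set G : EuclideanSpace ℝ (Fin 3) → ℝ := fun y => (‖ω σ y‖ ^ 2 + ε) ^ a - ε ^ a with hG
      have hΩc : HasCompactSupport (ω σ) :=
        HasCompactSupport.of_support_subset_isCompact hK fun y hy => by
          by_contra hyK; exact hy (hsupp σ hσ y hyK)
      have hG1 : ContDiff ℝ 1 G := contDiff_rpow_norm_sq_add hΩ1 hε a
      have hGc : HasCompactSupport G := hasCompactSupport_rpow_norm_sq_add hΩc ε a
      -- IBP: `∫ G div u + ∫ ⟪u, ∇G⟫ = 0`, `div u = 0`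
      have hibp := integral_mul_divergence_add_eq_zero_left hG1 hu1 hGc
      have hdiv0 : ∀ y, VectorCalculus.divergence (u σ) y = 0 := fun y => h.divFree σ hσS y
      simp_rw [hdiv0, mul_zero, integral_zero, zero_add] at hibp
      -- pointwise: `D = -⟪u, ∇G⟫ + stretching`
      have hpt : ∀ y, D (σ, y) = -⟪u σ y, gradient G y⟫ +
          2 * a * (‖ω σ y‖ ^ 2 + ε) ^ (a - 1) * ⟪ω σ y, fderiv ℝ (u σ) y (ω σ y)⟫ := by
        intro y
        have hveq := h.vorticity_eq σ hσS y
        rw [zero_smul, add_zero] at hveq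
        -- `∂ₜω = -(u·∇)ω + (ω·∇)u`
        have hωt_eq : timeDerivWithin S ω σ y =
            -convect (u σ) (ω σ) y + convect (ω σ) (u σ) y := by
          rw [hωdef]
          have := hveq
          rw [← eq_sub_iff_add_eq] at this
          rw [this]
          abel
        have hgrad : ⟪u σ y, gradient G y⟫ =
            2 * a * (‖ω σ y‖ ^ 2 + ε) ^ (a - 1) * ⟪ω σ y, convect (u σ) (ω σ) y⟫ := by
          rw [real_inner_comm, inner_gradient_left (𝕜 := ℝ), hG,
            fderiv_rpow_norm_sq_add_apply hΩd hε a, convect_apply]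
        simp only [hD]
        rw [hωt_eq, hgrad, inner_add_right, inner_neg_right, convect_apply (ω σ) (u σ)]
        ring
      have hI2 : Integrable (fun y => ⟪u σ y, gradient G y⟫) := by
        refine (hu1.continuous.inner (continuous_gradient_of_contDiff hG1))
          |>.integrable_of_hasCompactSupport (hGc.mono' fun x hx => ?_)
        contrapose! hx
        simp only [mem_support, not_not]
        rw [gradient_eq_zero_of_notMem_tsupport hx, inner_zero_right]
      -- the stretching integrand, its bound and integrability
      set R : EuclideanSpace ℝ (Fin 3) → ℝ := fun y =>
        2 * a * (‖ω σ y‖ ^ 2 + ε) ^ (a - 1) * ⟪ω σ y, fderiv ℝ (u σ) y (ω σ y)⟫ with hR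
      have hRle : ∀ y, |R y| ≤ K.indicator (fun _ => 2 * a * (Sd * max 1 F)) y := by
        intro y
        by_cases hy : y ∈ K
        · rw [indicator_of_mem hy]
          have hfe : 0 ≤ (‖ω σ y‖ ^ 2 + ε) ^ (a - 1) := Real.rpow_nonneg (by positivity) _
          have hst : |⟪ω σ y, fderiv ℝ (u σ) y (ω σ y)⟫| ≤ Sd * ‖ω σ y‖ ^ 2 := by
            calc |⟪ω σ y, fderiv ℝ (u σ) y (ω σ y)⟫|
                ≤ ‖ω σ y‖ * ‖fderiv ℝ (u σ) y (ω σ y)‖ := abs_real_inner_le_norm _ _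
              _ ≤ ‖ω σ y‖ * (Sd * ‖ω σ y‖) := by
                  refine mul_le_mul_of_nonneg_left ?_ (norm_nonneg _)
                  exact (ContinuousLinearMap.le_opNorm _ _).trans
                    (mul_le_mul_of_nonneg_right (hSd σ hσ y hy) (norm_nonneg _))
              _ = Sd * ‖ω σ y‖ ^ 2 := by ring
          have hkey : (‖ω σ y‖ ^ 2 + ε) ^ (a - 1) * ‖ω σ y‖ ^ 2 ≤ (‖ω σ y‖ ^ 2) ^ a :=
            rpow_sub_one_mul_le_rpow (sq_nonneg _) hε ha1
          have hfa := hfa_le σ hσ y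
          rw [indicator_of_mem hy] at hfa
          rw [hR, abs_mul, abs_mul, abs_of_pos (by positivity : (0 : ℝ) < 2 * a),
            abs_of_nonneg hfe]
          calc 2 * a * (‖ω σ y‖ ^ 2 + ε) ^ (a - 1) * |⟪ω σ y, fderiv ℝ (u σ) y (ω σ y)⟫|
              ≤ 2 * a * (‖ω σ y‖ ^ 2 + ε) ^ (a - 1) * (Sd * ‖ω σ y‖ ^ 2) := by gcongr
            _ = 2 * a * Sd * ((‖ω σ y‖ ^ 2 + ε) ^ (a - 1) * ‖ω σ y‖ ^ 2) := by ring
            _ ≤ 2 * a * Sd * (‖ω σ y‖ ^ 2) ^ a := by gcongr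
            _ ≤ 2 * a * Sd * max 1 F := by gcongr
            _ = 2 * a * (Sd * max 1 F) := by ring
        · rw [indicator_of_notMem hy]
          simp only [hR, hsupp σ hσ y hy, inner_zero_left, mul_zero, abs_zero, le_refl]
      have hRint : Integrable R := by
        have hRc : Continuous R := by
          have h1 : Continuous fun y => (‖ω σ y‖ ^ 2 + ε) ^ (a - 1) :=
            ((hΩ1.continuous.norm.pow 2).add continuous_const).rpow_const fun y =>
              Or.inl (ne_of_gt (add_pos_of_nonneg_of_pos (sq_nonneg _) hε))
          exact (continuous_const.mul h1).mul (hΩ1.continuous.inner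
            ((hu1.continuous_fderiv one_ne_zero).clm_apply hΩ1.continuous))
        refine hRc.integrable_of_hasCompactSupport (hΩc.mono fun y hy => ?_)
        rw [mem_support] at hy ⊢
        contrapose! hy
        simp [hR, hy]
      -- assemble the slice
      have hDsplit : (fun y => D (σ, y)) = fun y => R y - ⟪u σ y, gradient G y⟫ :=
        funext fun y => by rw [hpt y]; ring
      rw [hDsplit, integral_sub hRint hI2, hibp, sub_zero]
      calc |∫ y, R y| ≤ ∫ y, |R y| := abs_integral_le_integral_abs
        _ ≤ ∫ y, K.indicator (fun _ => 2 * a * (Sd * max 1 F)) y :=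
            integral_mono hRint.abs ((integrable_indicator_iff hK.measurableSet).2
              (integrableOn_const (C := 2 * a * (Sd * max 1 F)) hK.measure_lt_top.ne)) hRle
        _ = 2 * a * C := by
            rw [integral_indicator_const _ hK.measurableSet, smul_eq_mul, hCdef]
            ring
    -- assemble: Fubini + the two bounds
    have hI : ∀ {r : ℝ}, r ∈ Icc τ₁ τ₂ →
        Integrable (fun x => (‖ω r x‖ ^ 2 + ε) ^ a - ε ^ a) := fun {r} hr =>
      (contDiff_rpow_norm_sq_add (hωs r (hsub hr)) hε a).continuous.integrable_of_hasCompactSupport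
        (hasCompactSupport_rpow_norm_sq_add
          (HasCompactSupport.of_support_subset_isCompact hK fun y hy => by
            by_contra hyK; exact hy (hsupp r hr y hyK)) ε a)
    have hdiff : (∫ x, ((‖ω τ₂ x‖ ^ 2 + ε) ^ a - ε ^ a)) - ∫ x, ((‖ω τ₁ x‖ ^ 2 + ε) ^ a - ε ^ a) =
        ∫ σ in Ioo τ₁ τ₂, ∫ x, D (σ, x) := by
      rw [← integral_sub (hI (right_mem_Icc.2 hτ)) (hI (left_mem_Icc.2 hτ)), hswap]
      exact integral_congr_ae (Eventually.of_forall fun x => (hline x).symm)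
    rw [hdiff]
    have hvol : volume.real (Ioo τ₁ τ₂) = τ₂ - τ₁ := by
      rw [measureReal_def, Real.volume_Ioo, ENNReal.toReal_ofReal (by linarith)]
    calc |∫ σ in Ioo τ₁ τ₂, ∫ x, D (σ, x)|
        = ‖∫ σ in Ioo τ₁ τ₂, ∫ x, D (σ, x)‖ := (Real.norm_eq_abs _).symm
      _ ≤ (2 * a * C) * volume.real (Ioo τ₁ τ₂) := by
          refine norm_setIntegral_le_of_norm_le_const measure_Ioo_lt_top fun σ hσ => ?_
          rw [Real.norm_eq_abs]
          exact hslice σ (Ioo_subset_Icc_self hσ)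
      _ = 2 * a * C * (τ₂ - τ₁) := by rw [hvol]
  -- `ε → 0`
  have hlim : ∀ {r : ℝ}, r ∈ Icc τ₁ τ₂ → Tendsto (fun n : ℕ =>
      ∫ x, ((‖ω r x‖ ^ 2 + 1 / ((n : ℝ) + 1)) ^ a - (1 / ((n : ℝ) + 1)) ^ a)) atTop
      (𝓝 (∫ x, (‖ω r x‖ ^ 2) ^ a)) := by
    intro r hr
    have hεn : ∀ n : ℕ, (0 : ℝ) < 1 / ((n : ℝ) + 1) := fun n => by positivity
    have hr1 : ContDiff ℝ 1 (ω r) := hωs r (hsub hr)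
    have hKint : Integrable (K.indicator fun _ : EuclideanSpace ℝ (Fin 3) => max 1 F) :=
      (integrable_indicator_iff hK.measurableSet).2 (integrableOn_const hK.measure_lt_top.ne)
    have hfa_int : Integrable (fun x => (‖ω r x‖ ^ 2) ^ a) := by
      refine Integrable.mono' hKint
        ((hr1.continuous.norm.pow 2).rpow_const fun _ => Or.inr ha.le).aestronglyMeasurable
        (ae_of_all _ fun x => ?_)
      rw [Real.norm_eq_abs, abs_of_nonneg (Real.rpow_nonneg (sq_nonneg _) _)]
      exact hfa_le r hr x
    refine tendsto_integral_of_dominated_convergence (fun x => (‖ω r x‖ ^ 2) ^ a)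
      (fun n => ((contDiff_rpow_norm_sq_add hr1 (hεn n) a).continuous).aestronglyMeasurable)
      hfa_int (fun n => ae_of_all _ fun x => ?_) (ae_of_all _ fun x => ?_)
    · have hm := rpow_add_sub_rpow_mem_Icc (sq_nonneg ‖ω r x‖) (hεn n) ha.le ha1
      rw [Real.norm_eq_abs, abs_of_nonneg hm.1]
      exact hm.2
    · exact tendsto_rpow_add_sub_rpow (‖ω r x‖ ^ 2) ha
  have hlim2 := (hlim (right_mem_Icc.2 hτ)).sub (hlim (left_mem_Icc.2 hτ))
  have hlim3 := hlim2.abs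
  refine le_of_tendsto hlim3 (Eventually.of_forall fun n => ?_)
  exact hlevel _ (by positivity)

/-- **Conservation of the volume of the vorticity support** (Majda–Bertozzi §1.6 Prop. 1.8 with
§1.3 Prop. 1.4: the vorticity is transported by the volume-preserving flow, so `supp ω(t) = X(supp
ω₀, t)` has constant measure), Eulerian version: for an Euler vorticity-form solution on an open
time set `S ⊇ [τ₁, τ₂]` whose vorticity vanishes off a fixed compact set `K` for all `σ ∈ [τ₁,τ₂]`,
`vol {x | ω(τ₂, x) ≠ 0} = vol {x | ω(τ₁, x) ≠ 0}`. Proof: `∫ |ω(σ)|^{2a} → vol{ω(σ) ≠ 0}` as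
`a → 0⁺` (dominated convergence on `K`), while by `abs_integral_rpow_vorticity_sub_le` the
difference of the two integrals is `O(a)`. [cite: MajdaBertozziCUP2002, §1.6 Prop. 1.8 (eq. (1.51)) and §1.3 Prop. 1.4] -/
theorem volume_support_vorticity_eq (h : IsVorticitySolutionOn S 0 u) (hS : IsOpen S)
    {τ₁ τ₂ : ℝ} (hτ : τ₁ ≤ τ₂) (hsub : Icc τ₁ τ₂ ⊆ S) {K : Set (EuclideanSpace ℝ (Fin 3))}
    (hK : IsCompact K) (hsupp : ∀ σ ∈ Icc τ₁ τ₂, ∀ x ∉ K, vorticity u σ x = 0) :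
    volume {x | vorticity u τ₂ x ≠ 0} = volume {x | vorticity u τ₁ x ≠ 0} := by
  set ω : ℝ → EuclideanSpace ℝ (Fin 3) → EuclideanSpace ℝ (Fin 3) := vorticity u with hωdef
  have hU : UniqueDiffOn ℝ S := hS.uniqueDiffOn
  have hu := h.smooth_velocity
  have hω : IsSmoothSpaceTimeOn S ω := hu.isSmoothSpaceTimeOn_vorticity hU
  have hDu : IsSmoothSpaceTimeOn S (fun s y => fderiv ℝ (u s) y) := hu.fderiv_slice hU
  have hω_cont : ContinuousOn (uncurry ω) (Icc τ₁ τ₂ ×ˢ univ) :=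
    hω.continuousOn.mono (prod_mono hsub Subset.rfl)
  have hDu_cont : ContinuousOn (uncurry fun s y => fderiv ℝ (u s) y) (Icc τ₁ τ₂ ×ˢ univ) :=
    hDu.continuousOn.mono (prod_mono hsub Subset.rfl)
  -- bounds on the compact set `[τ₁, τ₂] × K`
  have hcpt : IsCompact (Icc τ₁ τ₂ ×ˢ K) := isCompact_Icc.prod hK
  set gD : ℝ × EuclideanSpace ℝ (Fin 3) → ℝ := fun z => ‖fderiv ℝ (u z.1) z.2‖ with hgD
  have hgDc : ContinuousOn gD (Icc τ₁ τ₂ ×ˢ K) :=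
    (hDu_cont.mono (prod_mono Subset.rfl (subset_univ K))).norm
  obtain ⟨Sd, hSd⟩ : ∃ Sd : ℝ, ∀ σ ∈ Icc τ₁ τ₂, ∀ x ∈ K, ‖fderiv ℝ (u σ) x‖ ≤ Sd := by
    obtain ⟨B, hB⟩ := hcpt.bddAbove_image hgDc
    refine ⟨B, fun σ hσ x hx => ?_⟩
    have hmem : gD (σ, x) ∈ gD '' (Icc τ₁ τ₂ ×ˢ K) := mem_image_of_mem gD (mk_mem_prod hσ hx)
    exact hB hmem
  set gF : ℝ × EuclideanSpace ℝ (Fin 3) → ℝ := fun z => ‖ω z.1 z.2‖ ^ 2 with hgF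
  have hgFc : ContinuousOn gF (Icc τ₁ τ₂ ×ˢ K) :=
    ((hω_cont.mono (prod_mono Subset.rfl (subset_univ K))).norm).pow 2
  obtain ⟨F, hF⟩ : ∃ F : ℝ, ∀ σ ∈ Icc τ₁ τ₂, ∀ x, ‖ω σ x‖ ^ 2 ≤ F := by
    obtain ⟨B, hB⟩ := hcpt.bddAbove_image hgFc
    refine ⟨max B 0, fun σ hσ x => ?_⟩
    by_cases hx : x ∈ K
    · have hmem : gF (σ, x) ∈ gF '' (Icc τ₁ τ₂ ×ˢ K) := mem_image_of_mem gF (mk_mem_prod hσ hx)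
      exact (hB hmem).trans (le_max_left _ _)
    · rw [hsupp σ hσ x hx, norm_zero]
      simp
  have hF0 : 0 ≤ F := (sq_nonneg _).trans (hF τ₁ (left_mem_Icc.2 hτ) 0)
  set C : ℝ := Sd * max 1 F * volume.real K with hCdef
  -- the `O(a)` bound along `a_n = 1/(n+1)`
  have han : ∀ n : ℕ, (0 : ℝ) < 1 / ((n : ℝ) + 1) := fun n => by positivity
  have han1 : ∀ n : ℕ, (1 : ℝ) / ((n : ℝ) + 1) ≤ 1 := fun n => by
    rw [div_le_one (by positivity)]
    have : (0 : ℝ) ≤ n := Nat.cast_nonneg n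
    linarith
  have hbound : ∀ n : ℕ,
      |(∫ x, (‖ω τ₂ x‖ ^ 2) ^ (1 / ((n : ℝ) + 1))) - ∫ x, (‖ω τ₁ x‖ ^ 2) ^ (1 / ((n : ℝ) + 1))| ≤
        2 * (1 / ((n : ℝ) + 1)) * C * (τ₂ - τ₁) := fun n =>
    h.abs_integral_rpow_vorticity_sub_le hS hτ hsub hK hsupp hSd hF (han n) (han1 n)
  -- `∫ |ω(σ)|^{2aₙ} → vol {ω(σ) ≠ 0}`
  have hmeas : ∀ σ ∈ Icc τ₁ τ₂, MeasurableSet {x | ω σ x ≠ 0} := fun σ hσ =>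
    (isOpen_ne_fun (hω.contDiff_slice (hsub hσ)).continuous continuous_const).measurableSet
  have hsubK : ∀ σ ∈ Icc τ₁ τ₂, {x | ω σ x ≠ 0} ⊆ K := fun σ hσ x hx => by
    by_contra hxK; exact hx (hsupp σ hσ x hxK)
  have hlim : ∀ σ ∈ Icc τ₁ τ₂, Tendsto (fun n : ℕ => ∫ x, (‖ω σ x‖ ^ 2) ^ (1 / ((n : ℝ) + 1)))
      atTop (𝓝 (volume.real {x | ω σ x ≠ 0})) := by
    intro σ hσ
    have hσc : Continuous (ω σ) := (hω.contDiff_slice (hsub hσ)).continuous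
    rw [← integral_indicator_one (hmeas σ hσ)]
    have hKint : Integrable (K.indicator fun _ : EuclideanSpace ℝ (Fin 3) => max 1 F) :=
      (integrable_indicator_iff hK.measurableSet).2 (integrableOn_const hK.measure_lt_top.ne)
    refine tendsto_integral_of_dominated_convergence (K.indicator fun _ => max 1 F)
      (fun n => ((hσc.norm.pow 2).rpow_const fun _ => Or.inr (han n).le).aestronglyMeasurable)
      hKint (fun n => ae_of_all _ fun x => ?_) (ae_of_all _ fun x => ?_)
    · rw [Real.norm_eq_abs, abs_of_nonneg (Real.rpow_nonneg (sq_nonneg _) _)]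
      by_cases hx : x ∈ K
      · rw [indicator_of_mem hx]
        by_cases h1 : ‖ω σ x‖ ^ 2 ≤ 1
        · exact (Real.rpow_le_one (sq_nonneg _) h1 (han n).le).trans (le_max_left _ _)
        · have h1' : 1 ≤ ‖ω σ x‖ ^ 2 := (not_le.1 h1).le
          calc (‖ω σ x‖ ^ 2) ^ (1 / ((n : ℝ) + 1)) ≤ (‖ω σ x‖ ^ 2) ^ (1 : ℝ) :=
                Real.rpow_le_rpow_of_exponent_le h1' (han1 n)
            _ = ‖ω σ x‖ ^ 2 := Real.rpow_one _
            _ ≤ max 1 F := (hF σ hσ x).trans (le_max_right _ _)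
      · rw [indicator_of_notMem hx, hsupp σ hσ x hx, norm_zero, zero_pow two_ne_zero,
          Real.zero_rpow (han n).ne']
    · by_cases hx : ω σ x = 0
      · have hnot : x ∉ {x | ω σ x ≠ 0} := fun hmem => hmem hx
        rw [indicator_of_notMem hnot, hx, norm_zero]
        simp only [ne_eq, OfNat.ofNat_ne_zero, not_false_eq_true, zero_pow]
        refine tendsto_const_nhds.congr fun n => ?_
        rw [Real.zero_rpow (han n).ne']
      · have hmem : x ∈ {x | ω σ x ≠ 0} := hx
        rw [indicator_of_mem hmem, Pi.one_apply]
        have hpos : 0 < ‖ω σ x‖ ^ 2 := by positivity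
        have hcont : ContinuousAt (fun b : ℝ => (‖ω σ x‖ ^ 2) ^ b) 0 :=
          (Real.continuous_const_rpow hpos.ne').continuousAt
        have h0 : Tendsto (fun n : ℕ => (1 : ℝ) / ((n : ℝ) + 1)) atTop (𝓝 0) :=
          tendsto_one_div_add_atTop_nhds_zero_nat
        have := hcont.tendsto.comp h0
        rwa [Real.rpow_zero] at this
  -- conclude: the real volumes agree, hence the volumes (both finite)
  have hreal : volume.real {x | ω τ₂ x ≠ 0} = volume.real {x | ω τ₁ x ≠ 0} := by
    have hdiff := ((hlim τ₂ (right_mem_Icc.2 hτ)).sub (hlim τ₁ (left_mem_Icc.2 hτ))).abs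
    have hzero : Tendsto (fun n : ℕ => 2 * (1 / ((n : ℝ) + 1)) * C * (τ₂ - τ₁)) atTop (𝓝 0) := by
      have h0 : Tendsto (fun n : ℕ => (1 : ℝ) / ((n : ℝ) + 1)) atTop (𝓝 0) :=
        tendsto_one_div_add_atTop_nhds_zero_nat
      have := ((h0.const_mul 2).mul_const C).mul_const (τ₂ - τ₁)
      simpa using this
    have hle : |volume.real {x | ω τ₂ x ≠ 0} - volume.real {x | ω τ₁ x ≠ 0}| ≤ 0 :=
      le_of_tendsto_of_tendsto hdiff hzero (Eventually.of_forall hbound)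
    have := abs_nonpos_iff.1 hle
    linarith
  have hfin : ∀ σ ∈ Icc τ₁ τ₂, volume {x | ω σ x ≠ 0} ≠ ⊤ := fun σ hσ =>
    (measure_mono (hsubK σ hσ) |>.trans_lt hK.measure_lt_top).ne
  rw [measureReal_def, measureReal_def] at hreal
  exact (ENNReal.toReal_eq_toReal_iff' (hfin τ₂ (right_mem_Icc.2 hτ))
    (hfin τ₁ (left_mem_Icc.2 hτ))).1 hreal

end IsVorticitySolutionOn

end Literature.Analysis.FluidPDE

end
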